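import Mathlib
import HarnessLib
import Summits.NavierStokesRegularity.NavierStokesRegularity.Theorems.PoloidalWindowDoorLrcModEntireQ4CurvedTranslationPeriodic

/-!
# Route `PoloidalWindowDoor`, item `LrcModEntire` (stmt-NavierStokesRegularity-20428), cell (Q4-curved), VERTICAL child —
# THE SLICE IS DETERMINED BY ITS VERTICAL-CURTAIN DATA (analytic Cauchy uniqueness across a curved vertical critical cylinder)

Cell ns-regularity-ideate, stub-worker seat ns-poloidal-K2-p2 g19 under the LEAD of item 20428 (ns-poloidal-K2-p3 g18); `--supports stmt-NavierStokesRegularity-20428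
--as helper`.  Kernel form of memo `Y-LADDER-K2p2g19.md` §6(b) (first half): in the vertical-curtain residue of (Q4) (`…CurvedLimitsUniformlyCurvedNoAsymptoticPeriod` after v19)
every translation-hull element carries the SAME slope function `μ(−1,·)` and the SAME vertical profile `R̃` on its curtain; this file shows that these data together with the base
curve DETERMINE the vertical component of the time `−1` slice on all of `ℝ³` — the abstraction of the Cauchy–Kovalevskaya step inside LEMMA P
(`…Q4CurvedTranslationPeriodic.false_of_translation_limit_periodic`, where the second solution is the translate of the first).

* ★ `eq_of_verticalCurtainData` — CLASS-FREE: two real-analytic functions `θ₁, θ₂ : ℝ³ → ℝ` solving the slice law `∂₂²θ = −μ(x₂)·Δₕθ` on the slab `{x₂ ∈ I}` (`I` open), both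
  horizontally critical on the vertical cylinder `{Γ s + z e₂ : z ∈ I}` over a `C²` planar unit-speed curve `Γ` and with the same values there, agree on `ℝ³` as soon as ONE height
  `z₀ ∈ I` is non-characteristic (`μ z₀ ≠ 0`, `μ` continuous on `I`).  Proof: `w := θ₁ − θ₂` has zero Cauchy data on the cylinder piece over `J := I ∩ {μ ≠ 0}` (values by
  hypothesis; gradients: horizontal slots by criticality, vertical slot = derivative of the common vertical profile), so `…CurvedSheetUniqueness.eqOn_zero_nhds_of_sheet` (K2-p2 g16,
  offset `d ≡ 0`) makes `w` vanish near a sheet point, and the identity theorem on `ℝ³` finishes.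
* ★ `slice_two_eq_of_verticalCurtainData` — CLASS LEVEL: two profiles of the route's class (quadruple each) obeying the same slab slope law `∂₂U_b = μ(t,x₂)∂_bU₂` on
  `|t+1| < ρ`, `|x₂| < ρ` (`0 < ρ`, `μ(−1,·)` continuous), horizontally critical in their vertical components on the same cylinder `Γ × ℝ` with the same values there, and
  `μ(−1,·) ≢ 0` on `(−ρ, ρ)`, have the same vertical component at time `−1`: `U¹₂(−1,·) = U²₂(−1,·)`.

WHAT THIS IS NOT: not a claim about Navier–Stokes regularity; a rigidity lemma for the research residue of the (Q4) column (registry v18/v19 of item 20428); it closes nothing;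
items 20428 / 19708 / 27893 OPEN (bears_on LADDER-NS N0).
-/

noncomputable section

set_option linter.dupNamespace false
set_option linter.style.longLine false

namespace Summit.NavierStokesRegularity.NavierStokesRegularity.Theorems.PoloidalWindowDoorLrcModEntireVerticalCurtainUniqueness

open Set Function Filter Topology Metric
open scoped RealInnerProductSpace InnerProductSpace ContDiff
open Literature.Analysis Literature.Analysis.FluidPDE Literature.Analysis.UnboundedOperators
open Summit.NavierStokesRegularity.NavierStokesRegularity.Theorems
open Summit.NavierStokesRegularity.NavierStokesRegularity.Theorems.PoloidalWindowDoorLrcModEntireQ4CurvedTranslationPeriodic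
open Summit.NavierStokesRegularity.NavierStokesRegularity.Theorems.PoloidalWindowDoorLrcModEntirePlanarCurveRigidity
open Summit.NavierStokesRegularity.NavierStokesRegularity.Theorems.PoloidalWindowDoorLrcModEntireSheetFlattenTools
open Summit.NavierStokesRegularity.NavierStokesRegularity.Theorems.PoloidalWindowDoorLrcModEntireRidgeGlobalBranchFrame
open Summit.NavierStokesRegularity.NavierStokesRegularity.Theorems.PoloidalWindowDoorLrcModEntireCurvedSheetUniqueness
open Summit.NavierStokesRegularity.NavierStokesRegularity.Theorems.PoloidalWindowDoorLrcModEntireQ4CurvedPeriodic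
open Summit.NavierStokesRegularity.NavierStokesRegularity.Theorems.PoloidalWindowDoorPoloidalWindowRigidityTimeHeightShearLinearSlice
open Summit.NavierStokesRegularity.NavierStokesRegularity.Theorems.PoloidalWindowDoorPoloidalWindowRigidityConstantShearSlice
open Summit.NavierStokesRegularity.NavierStokesRegularity.Theorems.LocalSineTubeDoorProfileAlignedWindowRigidityAncient

/-! ### A. Class-free uniqueness across the cylinder -/

/-- ★ **TWO ANALYTIC SOLUTIONS OF THE SLICE LAW WITH THE SAME VERTICAL-CURTAIN DATA COINCIDE.**  See the module docstring. -/
theorem eq_of_verticalCurtainData {θ₁ θ₂ : EuclideanSpace ℝ (Fin 3) → ℝ} (hθ₁ : AnalyticOnNhd ℝ θ₁ univ) (hθ₂ : AnalyticOnNhd ℝ θ₂ univ)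
    {I : Set ℝ} (hI : IsOpen I) {μ : ℝ → ℝ} (hμc : ContinuousOn μ I) {z₀ : ℝ} (hz₀ : z₀ ∈ I) (hμz₀ : μ z₀ ≠ 0)
    (hlaw₁ : ∀ x : EuclideanSpace ℝ (Fin 3), x 2 ∈ I →
      fderiv ℝ (fun y => fderiv ℝ θ₁ y (EuclideanSpace.single 2 (1 : ℝ))) x (EuclideanSpace.single 2 (1 : ℝ)) =
        -μ (x 2) * (fderiv ℝ (fun y => fderiv ℝ θ₁ y (EuclideanSpace.single 0 (1 : ℝ))) x (EuclideanSpace.single 0 (1 : ℝ)) +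
          fderiv ℝ (fun y => fderiv ℝ θ₁ y (EuclideanSpace.single 1 (1 : ℝ))) x (EuclideanSpace.single 1 (1 : ℝ))))
    (hlaw₂ : ∀ x : EuclideanSpace ℝ (Fin 3), x 2 ∈ I →
      fderiv ℝ (fun y => fderiv ℝ θ₂ y (EuclideanSpace.single 2 (1 : ℝ))) x (EuclideanSpace.single 2 (1 : ℝ)) =
        -μ (x 2) * (fderiv ℝ (fun y => fderiv ℝ θ₂ y (EuclideanSpace.single 0 (1 : ℝ))) x (EuclideanSpace.single 0 (1 : ℝ)) +
          fderiv ℝ (fun y => fderiv ℝ θ₂ y (EuclideanSpace.single 1 (1 : ℝ))) x (EuclideanSpace.single 1 (1 : ℝ))))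
    {Γ : ℝ → EuclideanSpace ℝ (Fin 3)} (hΓ : ContDiff ℝ 2 Γ) (hΓ2 : ∀ s, Γ s 2 = 0) (hunit : ∀ s, ‖deriv Γ s‖ = 1)
    (hcrit₁ : ∀ s : ℝ, ∀ z ∈ I, ∀ w : EuclideanSpace ℝ (Fin 3), w 2 = 0 → fderiv ℝ θ₁ (Γ s + z • EuclideanSpace.single 2 (1 : ℝ)) w = 0)
    (hcrit₂ : ∀ s : ℝ, ∀ z ∈ I, ∀ w : EuclideanSpace ℝ (Fin 3), w 2 = 0 → fderiv ℝ θ₂ (Γ s + z • EuclideanSpace.single 2 (1 : ℝ)) w = 0)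
    (hvals : ∀ s : ℝ, ∀ z ∈ I, θ₁ (Γ s + z • EuclideanSpace.single 2 (1 : ℝ)) = θ₂ (Γ s + z • EuclideanSpace.single 2 (1 : ℝ))) :
    θ₁ = θ₂ := by
  have he2 : (EuclideanSpace.single 2 (1 : ℝ) : EuclideanSpace ℝ (Fin 3)) = e2 := rfl
  have hθ₁C : ContDiff ℝ ∞ θ₁ := contDiffOn_univ.1 hθ₁.contDiffOn_of_completeSpace
  have hθ₂C : ContDiff ℝ ∞ θ₂ := contDiffOn_univ.1 hθ₂.contDiffOn_of_completeSpace
  have hθ₁d : Differentiable ℝ θ₁ := hθ₁C.differentiable (by simp)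
  have hθ₂d : Differentiable ℝ θ₂ := hθ₂C.differentiable (by simp)
  -- the non-characteristic part of the slab
  set J : Set ℝ := I ∩ μ ⁻¹' ({0}ᶜ) with hJ_def
  have hJo : IsOpen J := hμc.isOpen_inter_preimage hI isOpen_compl_singleton
  have hz₀J : z₀ ∈ J := ⟨hz₀, hμz₀⟩
  have hJI : ∀ z ∈ J, z ∈ I := fun z hz => hz.1
  -- the difference and its slice law
  set w : EuclideanSpace ℝ (Fin 3) → ℝ := fun y => θ₁ y - θ₂ y with hw_def
  have hwan : AnalyticOnNhd ℝ w univ := fun x hx => (hθ₁ x hx).sub (hθ₂ x hx)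
  have hnested : ∀ (x a b : EuclideanSpace ℝ (Fin 3)),
      fderiv ℝ (fun y => fderiv ℝ w y b) x a = fderiv ℝ (fun y => fderiv ℝ θ₁ y b) x a - fderiv ℝ (fun y => fderiv ℝ θ₂ y b) x a := by
    intro x a b
    have h1 : (fun y => fderiv ℝ w y b) = fun y => fderiv ℝ θ₁ y b - fderiv ℝ θ₂ y b := by
      funext y
      rw [hw_def, fderiv_fun_sub (hθ₁d y) (hθ₂d y)]
      rfl
    rw [h1]
    have hg₁ : Differentiable ℝ (fun y => fderiv ℝ θ₁ y b) :=
      ((hθ₁C.fderiv_right (m := 1) (by norm_cast)).clm_apply contDiff_const).differentiable (by norm_cast)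
    have hg₂ : Differentiable ℝ (fun y => fderiv ℝ θ₂ y b) :=
      ((hθ₂C.fderiv_right (m := 1) (by norm_cast)).clm_apply contDiff_const).differentiable (by norm_cast)
    rw [fderiv_fun_sub (hg₁ x) (hg₂ x)]
    rfl
  have hlaww : ∀ x : EuclideanSpace ℝ (Fin 3), x 2 ∈ J →
      fderiv ℝ (fun y => fderiv ℝ w y (EuclideanSpace.single 2 (1 : ℝ))) x (EuclideanSpace.single 2 (1 : ℝ)) =
        -μ (x 2) * (fderiv ℝ (fun y => fderiv ℝ w y (EuclideanSpace.single 0 (1 : ℝ))) x (EuclideanSpace.single 0 (1 : ℝ)) +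
          fderiv ℝ (fun y => fderiv ℝ w y (EuclideanSpace.single 1 (1 : ℝ))) x (EuclideanSpace.single 1 (1 : ℝ))) := by
    intro x hx
    rw [hnested, hnested, hnested, hlaw₁ x (hJI _ hx), hlaw₂ x (hJI _ hx)]
    ring
  -- Frenet law of the base curve; the cylinder as the sheet with offset `d ≡ 0`
  have hk : ∀ s, deriv (deriv Γ) s = (fun s => ⟪deriv (deriv Γ) s, rotJ (deriv Γ s)⟫_ℝ) s • rotJ (deriv Γ s) := fun s =>
    deriv_deriv_eq_curvature_smul hΓ hΓ2 hunit s
  have hpt0 : ∀ s z : ℝ, Γ s + (fun _ : ℝ => (0 : ℝ)) z • rotJ (deriv Γ s) + z • e2 = Γ s + z • EuclideanSpace.single 2 (1 : ℝ) := by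
    intro s z; simp only [zero_smul, add_zero, he2]
  -- zero Cauchy data: values
  have h0 : ∀ s : ℝ, ∀ z ∈ J, w (Γ s + (fun _ : ℝ => (0 : ℝ)) z • rotJ (deriv Γ s) + z • e2) = 0 := by
    intro s z hz
    rw [hpt0]
    show θ₁ (Γ s + z • EuclideanSpace.single 2 (1 : ℝ)) - θ₂ (Γ s + z • EuclideanSpace.single 2 (1 : ℝ)) = 0
    rw [hvals s z (hJI _ hz), sub_self]
  -- the vertical derivatives on the cylinder agree (derivative of the common vertical profile, eventually in `z`)
  have hvert : ∀ s : ℝ, ∀ z ∈ J, fderiv ℝ θ₁ (Γ s + z • EuclideanSpace.single 2 (1 : ℝ)) (EuclideanSpace.single 2 (1 : ℝ)) =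
      fderiv ℝ θ₂ (Γ s + z • EuclideanSpace.single 2 (1 : ℝ)) (EuclideanSpace.single 2 (1 : ℝ)) := by
    intro s z hz
    rw [he2, fderiv_line_e2 hθ₁d (Γ s) z, fderiv_line_e2 hθ₂d (Γ s) z]
    -- the two line functions agree on a neighbourhood of `z` (the open set `I`)
    refine Filter.EventuallyEq.deriv_eq ?_
    have hev : ∀ᶠ z' in 𝓝 z, z' ∈ I := hI.mem_nhds (hJI _ hz)
    filter_upwards [hev] with z' hz'
    rw [← he2]
    exact hvals s z' hz'
  -- zero Cauchy data: gradients
  have h1 : ∀ s : ℝ, ∀ z ∈ J, fderiv ℝ w (Γ s + (fun _ : ℝ => (0 : ℝ)) z • rotJ (deriv Γ s) + z • e2) = 0 := by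
    intro s z hz
    rw [hpt0]
    set P : EuclideanSpace ℝ (Fin 3) := Γ s + z • EuclideanSpace.single 2 (1 : ℝ) with hP
    have hfw : fderiv ℝ w P = fderiv ℝ θ₁ P - fderiv ℝ θ₂ P := by
      rw [hw_def, fderiv_fun_sub (hθ₁d P) (hθ₂d P)]
    rw [hfw, sub_eq_zero]
    refine clm_eq_of_apply_single fun i => ?_
    fin_cases i
    · rw [hcrit₁ s z (hJI _ hz) _ (by simp), hcrit₂ s z (hJI _ hz) _ (by simp)]
    · rw [hcrit₁ s z (hJI _ hz) _ (by simp), hcrit₂ s z (hJI _ hz) _ (by simp)]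
    · simp only [Fin.reduceFinMk]
      exact hvert s z hz
  -- CK across the non-characteristic cylinder piece, then the identity theorem
  have hdJ : ContDiffOn ℝ ∞ (fun _ : ℝ => (0 : ℝ)) J := contDiffOn_const
  have hJfac : ∀ s : ℝ, ∀ z ∈ J, 1 - (fun s => ⟪deriv (deriv Γ) s, rotJ (deriv Γ s)⟫_ℝ) s * (fun _ : ℝ => (0 : ℝ)) z ≠ 0 := by
    intro s z _; simp
  have hQ : ∀ z ∈ J, deriv (fun _ : ℝ => (0 : ℝ)) z ^ 2 + μ z ≠ 0 := by
    intro z hz; simpa using hz.2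
  have hev := eqOn_zero_nhds_of_sheet hwan hJo hdJ hΓ hΓ2 hunit hk hJfac (μ := μ) hlaww h0 h1 hQ 0 hz₀J
  have hzero := hwan.eqOn_zero_of_preconnected_of_eventuallyEq_zero isPreconnected_univ (mem_univ _) hev
  funext x
  have hx := hzero (mem_univ x)
  simp only [hw_def, Pi.zero_apply, sub_eq_zero] at hx
  exact hx

/-! ### B. Class level: two profiles with the same curtain data have the same vertical component at time `−1` -/

/-- ★ **CLASS LEVEL.**  See the module docstring. -/
theorem slice_two_eq_of_verticalCurtainData {C₁ C₂ : ℝ} {U₁ U₂ : ℝ → EuclideanSpace ℝ (Fin 3) → EuclideanSpace ℝ (Fin 3)}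
    (hrate₁ : HasTypeITimeDecay C₁ U₁) (hcont₁ : ContinuousOn (uncurry U₁) (Iio (0 : ℝ) ×ˢ univ))
    (hmild₁ : ∀ s t : ℝ, s < t → t < 0 → ∀ x, U₁ t x = heatExtension (U₁ s) (t - s) x - oseenDuhamel 1 s U₁ U₁ t x)
    (hdiv₁ : ∀ t < 0, VectorCalculus.IsDivFree (U₁ t))
    (hrate₂ : HasTypeITimeDecay C₂ U₂) (hcont₂ : ContinuousOn (uncurry U₂) (Iio (0 : ℝ) ×ˢ univ))
    (hmild₂ : ∀ s t : ℝ, s < t → t < 0 → ∀ x, U₂ t x = heatExtension (U₂ s) (t - s) x - oseenDuhamel 1 s U₂ U₂ t x)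
    (hdiv₂ : ∀ t < 0, VectorCalculus.IsDivFree (U₂ t))
    {μ : ℝ → ℝ → ℝ} {ρ : ℝ} (hρ : 0 < ρ) (hμc : Continuous (μ (-1))) (hμne : ∃ z₀ ∈ Ioo (-ρ) ρ, μ (-1) z₀ ≠ 0)
    (hslab₁ : ∀ t : ℝ, |t + 1| < ρ → ∀ x : EuclideanSpace ℝ (Fin 3), |x 2| < ρ → ∀ b : Fin 3, b ≠ 2 →
      fderiv ℝ (U₁ t) x (EuclideanSpace.single 2 1) b = μ t (x 2) * fderiv ℝ (U₁ t) x (EuclideanSpace.single b 1) 2)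
    (hslab₂ : ∀ t : ℝ, |t + 1| < ρ → ∀ x : EuclideanSpace ℝ (Fin 3), |x 2| < ρ → ∀ b : Fin 3, b ≠ 2 →
      fderiv ℝ (U₂ t) x (EuclideanSpace.single 2 1) b = μ t (x 2) * fderiv ℝ (U₂ t) x (EuclideanSpace.single b 1) 2)
    {Γ : ℝ → EuclideanSpace ℝ (Fin 3)} (hΓ : ContDiff ℝ 2 Γ) (hΓ2 : ∀ s, Γ s 2 = 0) (hunit : ∀ s, ‖deriv Γ s‖ = 1)
    (hcurt₁ : ∀ s z : ℝ, ∀ w : EuclideanSpace ℝ (Fin 3), w 2 = 0 → fderiv ℝ (fun y => U₁ (-1) y 2) (Γ s + z • EuclideanSpace.single 2 (1 : ℝ)) w = 0)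
    (hcurt₂ : ∀ s z : ℝ, ∀ w : EuclideanSpace ℝ (Fin 3), w 2 = 0 → fderiv ℝ (fun y => U₂ (-1) y 2) (Γ s + z • EuclideanSpace.single 2 (1 : ℝ)) w = 0)
    (hvals : ∀ s z : ℝ, U₁ (-1) (Γ s + z • EuclideanSpace.single 2 (1 : ℝ)) 2 = U₂ (-1) (Γ s + z • EuclideanSpace.single 2 (1 : ℝ)) 2) :
    (fun y => U₁ (-1) y 2) = fun y => U₂ (-1) y 2 := by
  have hs1 : (-1 : ℝ) < 0 := by norm_num
  -- analyticity and the slice laws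
  have han : ∀ {C : ℝ} {U : ℝ → EuclideanSpace ℝ (Fin 3) → EuclideanSpace ℝ (Fin 3)}, HasTypeITimeDecay C U → ContinuousOn (uncurry U) (Iio (0 : ℝ) ×ˢ univ) →
      (∀ s t : ℝ, s < t → t < 0 → ∀ x, U t x = heatExtension (U s) (t - s) x - oseenDuhamel 1 s U U t x) → (∀ t < 0, VectorCalculus.IsDivFree (U t)) →
      (∀ t : ℝ, |t + 1| < ρ → ∀ x : EuclideanSpace ℝ (Fin 3), |x 2| < ρ → ∀ b : Fin 3, b ≠ 2 →
        fderiv ℝ (U t) x (EuclideanSpace.single 2 1) b = μ t (x 2) * fderiv ℝ (U t) x (EuclideanSpace.single b 1) 2) →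
      AnalyticOnNhd ℝ (fun y => U (-1) y 2) univ ∧
      ∀ x : EuclideanSpace ℝ (Fin 3), x 2 ∈ Ioo (-ρ) ρ →
        fderiv ℝ (fun y => fderiv ℝ (fun y' => U (-1) y' 2) y (EuclideanSpace.single 2 (1 : ℝ))) x (EuclideanSpace.single 2 (1 : ℝ)) =
          -μ (-1) (x 2) * (fderiv ℝ (fun y => fderiv ℝ (fun y' => U (-1) y' 2) y (EuclideanSpace.single 0 (1 : ℝ))) x (EuclideanSpace.single 0 (1 : ℝ)) +
            fderiv ℝ (fun y => fderiv ℝ (fun y' => U (-1) y' 2) y (EuclideanSpace.single 1 (1 : ℝ))) x (EuclideanSpace.single 1 (1 : ℝ))) := by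
    intro C U hrate hcont hmild hdiv hslab
    have hUan : AnalyticOnNhd ℝ (U (-1)) univ := analyticOnNhd_slice hcont (bdd_of_hasTypeITimeDecay hrate) hmild hs1
    have hU2 : ContDiff ℝ 2 (U (-1)) := hUan.contDiff
    refine ⟨fun y _ => ((EuclideanSpace.proj (𝕜 := ℝ) (2 : Fin 3)).analyticAt _).comp (hUan y (mem_univ _)), fun x hx => ?_⟩
    have hplane : ∀ y : EuclideanSpace ℝ (Fin 3), y 2 = x 2 → ∀ b : Fin 3, b ≠ 2 →
        fderiv ℝ (U (-1)) y (EuclideanSpace.single 2 (1 : ℝ)) b = μ (-1) (x 2) * fderiv ℝ (U (-1)) y (EuclideanSpace.single b (1 : ℝ)) 2 := by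
      intro y hy b hb
      have h := hslab (-1) (by simpa using hρ) y (by rw [hy]; exact abs_lt.2 ⟨hx.1, hx.2⟩) b hb
      rw [hy] at h; exact h
    exact plane_wave_identity hU2 (fun y => div_coord (hdiv (-1) hs1) y) hplane rfl
  obtain ⟨hθ₁, hlaw₁⟩ := han hrate₁ hcont₁ hmild₁ hdiv₁ hslab₁
  obtain ⟨hθ₂, hlaw₂⟩ := han hrate₂ hcont₂ hmild₂ hdiv₂ hslab₂
  obtain ⟨z₀, hz₀, hμz₀⟩ := hμne
  exact eq_of_verticalCurtainData hθ₁ hθ₂ isOpen_Ioo hμc.continuousOn hz₀ hμz₀ hlaw₁ hlaw₂ hΓ hΓ2 hunit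
    (fun s z _ w hw => hcurt₁ s z w hw) (fun s z _ w hw => hcurt₂ s z w hw) (fun s z _ => hvals s z)

end Summit.NavierStokesRegularity.NavierStokesRegularity.Theorems.PoloidalWindowDoorLrcModEntireVerticalCurtainUniqueness

end
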